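import Summits.Parity.GeneralizedHardyLittlewood.Theorems.GoldbachHeathBrownDispersionHeathBrownMorozUniformClassDisplay104Pairs
import HarnessLib

/-!
# Crux `HeathBrownMorozUniform` (stmt-Parity-19915), line `parent-differencing`: the seam S4p `ClassPairsTypeI`
# (Heath-Brown's Lemma 3.2 for CLASS pair sums, filtered form)

Helper file (`--supports stmt-Parity-19915`).  The v3 skeleton `Cruxes/HeathBrownMorozUniform/Lines/parent_differencing.lean`
cuts the class display (10.4) at the tree's file seam `LeadingAPairs | LeadingA` and names the pairs half
`ClassPairsTypeI` (stub `stub_classPairsTypeI`, the first hypothesis of its `stub_classDisplay104`).  Its content is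
the landed `abs_sum_pairs_classCountA_sub_le` (`…ClassDisplay104Pairs`) up to one cosmetic difference: the `R`-sum of
the main term is FILTERED by `(d, N R) = 1` instead of assuming `(d, N R) = 1` on the support of `α`.  This file
proves that filtered form with the statement-def UNFOLDED verbatim (`classPairsTypeI_of_pairs`), so that the v3 stub
closes by `exact classPairsTypeI_of_pairs` and the v3 `stub_classDisplay104` by
`exact fun _ => classDisplay104_of_typeISqfreeSum_of_sigmaOneCoprime`:

* `class_sum_pairs_main_eq_filter` — the class main terms multiply, filtered form
  (`[(d, N(RJ)) = 1] = [(d, N R) = 1]·[(d, N J) = 1]` on coprime pairs; no coprimality assumed on `supp α`);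
* `classPairsTypeI_of_pairs` — S4p.

**Goldbach is not proved here** (FRONTIER formalisation rung `GoldbachHeathBrownDispersion` only).

References: [cite: HeathBrownActa2001, Lemma 3.2 and §10 pp. 61–62]; [cite: HeathBrownMoroz2004, Lemma 2.4 and Lemma 4.1].
Tree: `…ClassDisplay104Pairs` (`class_sum_pairs_abs_sub_main_le`, `coprime_absNorm_mul_iff`), `HeathBrownCubicLeadingAPairs`
(`isCoprime_of_isRough_of_absNorm_lt`, `squarefree_absNorm_mul_iff`, `rho₂_mul_of_coprime`), `HeathBrownMorozClassFLSequences`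
(`classSizeA`).
-/

noncomputable section

open Polynomial NumberField Finset Filter Topology

namespace Summit.Parity.GeneralizedHardyLittlewood.Theorems.GoldbachHeathBrownDispersionHeathBrownMorozUniform

open Literature.NumberTheory.Sieve.CubicSieve Literature.NumberTheory.Sieve.CubicPrimes
open Literature.NumberTheory.LFunctions.CubeRootTwoField

section PairSumsFiltered

variable {X η z L Rmax A B : ℝ} {d a b : ℕ}

open scoped Classical in
/-- **The class main terms multiply, filtered form** (cf. `class_sum_pairs_main_eq`): for `α` on `z`-rough ideals of
square-free norm, `β` on square-free ideals, `N(J) < L ≤ z`,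
`∑_{R,J} α_R β_J main_cl(RJ) = X_cl (∑_{R, (d,N R)=1} α_R ρ₂(R)/N(R)) (∑_{J ∈ 𝒯r, (d, N J) = 1} β_J ρ₂(J)/N(J))`,
`main_cl(D) = 𝟙[N D ∈ 𝒯r]·𝟙[(d, N D) = 1]·X_cl ρ₂(D)/N(D)` — the coprimality indicator splits over the coprime pair
`(R, J)` (`coprime_absNorm_mul_iff`). [cite: HeathBrownMoroz2004, Lemma 4.1] [cite: HeathBrownActa2001, §10 p. 62] -/
theorem class_sum_pairs_main_eq_filter (hz : L ≤ z) (𝓡 : Finset (Ideal (𝓞 K))) (α β : Ideal (𝓞 K) → ℝ)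
    (hα : ∀ R ∈ 𝓡, α R ≠ 0 → Squarefree (Ideal.absNorm R) ∧ IsRough z R)
    (hβ : ∀ J, β J ≠ 0 → Squarefree J) :
    ∑ R ∈ 𝓡, ∑ J ∈ (idealsLE ⌊L⌋₊).filter (fun J => (Ideal.absNorm J : ℝ) < L),
        α R * β J * (if Squarefree (Ideal.absNorm (R * J)) then
          (if Nat.Coprime d (Ideal.absNorm (R * J)) then
            classSizeA X η d * rho₂ (R * J) / Ideal.absNorm (R * J) else 0) else 0) =
      classSizeA X η d *
        (∑ R ∈ 𝓡.filter (fun R => Nat.Coprime d (Ideal.absNorm R)), α R * (rho₂ R / Ideal.absNorm R)) *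
        ∑ J ∈ ((idealsLE ⌊L⌋₊).filter (fun J => (Ideal.absNorm J : ℝ) < L)).filter
          (fun J => Squarefree (Ideal.absNorm J) ∧ Nat.Coprime d (Ideal.absNorm J)),
            β J * (rho₂ J / Ideal.absNorm J) := by
  rw [Finset.sum_filter, Finset.sum_filter, mul_assoc, Finset.sum_mul_sum, Finset.mul_sum]
  refine Finset.sum_congr rfl fun R hR => ?_
  rw [Finset.mul_sum]
  refine Finset.sum_congr rfl fun J hJ => ?_
  rw [mem_filter] at hJ
  obtain ⟨-, hJL⟩ := hJ
  by_cases hαR : α R = 0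
  · simp [hαR]
  by_cases hβJ : β J = 0
  · simp [hβJ]
  obtain ⟨hsq, hrough⟩ := hα R hR hαR
  have hJsq := hβ J hβJ
  have hiff := squarefree_absNorm_mul_iff hsq hrough (hJL.trans_le hz) (J := J)
  by_cases hJn : Squarefree (Ideal.absNorm J)
  · rw [if_pos (hiff.mpr hJn)]
    have hR0 : R ≠ ⊥ := fun h => by rw [h, Ideal.absNorm_bot] at hsq; exact not_squarefree_zero hsq
    have hJ0 : J ≠ ⊥ := fun h => by rw [h, Ideal.absNorm_bot] at hJn; exact not_squarefree_zero hJn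
    have hcop := isCoprime_of_isRough_of_absNorm_lt hrough hJ0 (hJL.trans_le hz)
    by_cases hRc : Nat.Coprime d (Ideal.absNorm R)
    · rw [if_pos hRc]
      by_cases hJc : Nat.Coprime d (Ideal.absNorm J)
      · rw [if_pos ((coprime_absNorm_mul_iff R J).mpr ⟨hRc, hJc⟩), if_pos ⟨hJn, hJc⟩]
        rw [rho₂_mul_of_coprime hR0 hJ0 hcop, map_mul, Nat.cast_mul]
        have hNR : (Ideal.absNorm R : ℝ) ≠ 0 := by exact_mod_cast (Squarefree.ne_zero hsq)
        have hNJ : (Ideal.absNorm J : ℝ) ≠ 0 := by exact_mod_cast (Squarefree.ne_zero hJn)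
        field_simp
      · rw [if_neg (fun h => hJc ((coprime_absNorm_mul_iff R J).mp h).2), if_neg (fun h => hJc h.2)]
        simp
    · rw [if_neg (fun h => hRc ((coprime_absNorm_mul_iff R J).mp h).1), if_neg hRc]
      simp
  · rw [if_neg (fun h => hJn (hiff.mp h)),
      if_neg (fun h : Squarefree (Ideal.absNorm J) ∧ Nat.Coprime d (Ideal.absNorm J) => hJn h.1)]
    simp

open scoped Classical in
/-- **S4p `ClassPairsTypeI` of the v3 skeleton `Lines/parent_differencing.lean`, PROVED** (statement-def UNFOLDED
verbatim): Heath-Brown's Lemma 3.2 for CLASS pair sums — for `α` supported on `z`-rough ideals `R` of square-free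
norm `≤ R_max` with `|α| ≤ A`, `β` on square-free ideals with `|β| ≤ B`, `J` over the ideals of norm `< L ≤ z`,
`|∑_{R,J} α_Rβ_J #𝒜_{cl,RJ} − X_cl·(∑_{R : (d, N R) = 1} α_Rρ₂(R)/N(R))·(∑_{J ∈ 𝒯r, (d, N J) = 1} β_Jρ₂(J)/N(J))|
 ≤ AB·∑_{N(D) ≤ R_maxL, D ∈ 𝒯r} |#𝒜_{cl,D} − [(d, N D) = 1]·X_clρ₂(D)/N(D)|`, `X_cl = (6η²X²/π²)(ζ(2)/ζ_d(2))d⁻²`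
(from `class_sum_pairs_abs_sub_main_le` and `class_sum_pairs_main_eq_filter`; no admissibility of the class needed).
[cite: HeathBrownActa2001, Lemma 3.2 and §10 pp. 61–62] [cite: HeathBrownMoroz2004, Lemma 2.4] -/
theorem classPairsTypeI_of_pairs :
    ∀ (d a b : ℕ) (X η z L Rmax A B : ℝ) (𝓡 : Finset (Ideal (𝓞 K))) (α β : Ideal (𝓞 K) → ℝ),
      0 ≤ X → L ≤ z → 0 ≤ Rmax →
      (∀ R ∈ 𝓡, α R ≠ 0 → Squarefree (Ideal.absNorm R) ∧ IsRough z R ∧ (Ideal.absNorm R : ℝ) ≤ Rmax) →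
      (∀ R ∈ 𝓡, |α R| ≤ A) → (∀ J, β J ≠ 0 → Squarefree J) →
      (∀ J ∈ (idealsLE ⌊L⌋₊).filter (fun J => (Ideal.absNorm J : ℝ) < L), |β J| ≤ B) → 0 ≤ A → 0 ≤ B →
        |(∑ R ∈ 𝓡, ∑ J ∈ (idealsLE ⌊L⌋₊).filter (fun J => (Ideal.absNorm J : ℝ) < L),
            α R * β J * (classCountA X η d a b (R * J) : ℝ)) -
          6 * η ^ 2 * X ^ 2 / Real.pi ^ 2 * zetaTwoCorrection d / (d : ℝ) ^ 2 *
            (∑ R ∈ 𝓡.filter (fun R => Nat.Coprime d (Ideal.absNorm R)), α R * (rho₂ R / Ideal.absNorm R)) *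
            ∑ J ∈ ((idealsLE ⌊L⌋₊).filter (fun J => (Ideal.absNorm J : ℝ) < L)).filter
              (fun J => Squarefree (Ideal.absNorm J) ∧ Nat.Coprime d (Ideal.absNorm J)),
              β J * (rho₂ J / Ideal.absNorm J)| ≤
          A * B * ∑ D ∈ (idealsLE ⌊Rmax * L⌋₊).filter (fun D => Squarefree (Ideal.absNorm D)),
            |(classCountA X η d a b D : ℝ) -
              (if Nat.Coprime d (Ideal.absNorm D) then
                6 * η ^ 2 * X ^ 2 / Real.pi ^ 2 * zetaTwoCorrection d / (d : ℝ) ^ 2 * rho₂ D /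
                  Ideal.absNorm D else 0)| := by
  intro d a b X η z L Rmax A B 𝓡 α β hX hz hRmax hα hαA hβ hβB hA hB
  have hcl : ∀ D : Ideal (𝓞 K), 6 * η ^ 2 * X ^ 2 / Real.pi ^ 2 * zetaTwoCorrection d / (d : ℝ) ^ 2 * rho₂ D /
      Ideal.absNorm D = classSizeA X η d * rho₂ D / Ideal.absNorm D := fun D => by rw [classSizeA]
  have hcl' : 6 * η ^ 2 * X ^ 2 / Real.pi ^ 2 * zetaTwoCorrection d / (d : ℝ) ^ 2 = classSizeA X η d := by
    rw [classSizeA]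
  simp only [hcl]
  rw [hcl', ← class_sum_pairs_main_eq_filter (X := X) (η := η) hz 𝓡 α β
    (fun R hR h => ⟨(hα R hR h).1, (hα R hR h).2.1⟩) hβ]
  refine le_trans ?_ (class_sum_pairs_abs_sub_main_le hX hz hRmax 𝓡 α β hα hαA hβ hβB hA hB)
  rw [← Finset.sum_sub_distrib]
  refine (Finset.abs_sum_le_sum_abs _ _).trans (Finset.sum_le_sum fun R _ => ?_)
  rw [← Finset.sum_sub_distrib]
  refine (Finset.abs_sum_le_sum_abs _ _).trans (Finset.sum_le_sum fun J _ => ?_)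
  rw [← mul_sub, abs_mul, abs_mul]

end PairSumsFiltered

end Summit.Parity.GeneralizedHardyLittlewood.Theorems.GoldbachHeathBrownDispersionHeathBrownMorozUniform

end
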